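import Summits.Ventures.HSemireg.WedgeHankelRecurrenceGaussChebyshevSCharP

/-!
# Venture HSemireg — **MONIC HALF-ANGLE FACTORISATIONS `C_{2k} + 2 = C_k²`, `C_{2k} − 2 = (X² − 4) S_{k−1}²`, `C_{2k+1} − 2 = (X − 2)(S_k + S_{k−1})²`, `C_{2k+1} + 2 = (X + 2)(S_k − S_{k−1})²`**
# for all `k ∈ ℤ` in EVERY commutative ring (no factor `2` to cancel, unlike the `T`-form N478: Cassini `S_k² − X S_k S_{k−1} + S_{k−1}² = 1` does the work), and the odd-index integer readings
# for the Lucas pair with `Q = 1`: **`V_{2k+1} − 2 = (P − 2)(U_{k+1} + U_k)²`**, **`V_{2k+1} + 2 = (P + 2)(U_{k+1} − U_k)²`** (the even-index readings `V_{2k} = V_k² − 2`, `V_{2k} − 2 = D U_k²` are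
# ALREADY in the tree as `Literature.NumberTheory.LucasSequences.RecurrenceIdentities.V_two_mul ∕ V_sq` for general `P, Q` and are not restated)

HONEST FRAMING. Part of the Lean index of the computation cell `pub-hsemireg` (seat p10 gen 48, Sunday typer «UNIFORM-IN-n»).  Polynomial ∕ integer algebra only; no variety, no cohomology theory, no
sheaf, no Ext group and no semiregularity map is constructed here; nothing here says that HC / HC_CM / HC_AV holds; no Literature fact (unproved `Prop`) is declared or used.  Custodian versions as
in `WedgeHankelSiegelIdeal` (1/3).
SOURCES (cited).  P. Ribenboim, *My Numbers, My Friends* (2000), Ch. 1, (IV.4)–(IV.6) (`V_{2n} = V_n² − 2Q^n`, `D U_n² = V_n² − 4Q^n` and the `V_n ± 2Q^{n∕2}` square identities); D. H. Lehmer, Ann. of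
Math. 31 (1930) 419–448, §2; J. C. Mason, D. C. Handscomb, *Chebyshev Polynomials* (2003), §1.2.4.
PROOF TYPED HERE.  N481 `chebyshevC_add_sub_C_sub`; Mathlib `C_mul_C`, `C_zero ∕ C_one`, `S_sq_add_S_sq`; N476 `lucasV_one_eq_chebyshevC_eval`; N483 `lucasU_one_eq_chebyshevS_eval`.
DEDUP DISCLOSURE (`rg -n 'chebyshevC_two_mul_add_two|chebyshevC_two_mul_sub_two|chebyshevC_two_mul_add_one_sub_two|chebyshevC_two_mul_add_one_add_two|lucasV_one_two_mul|V_two_mul|V_sq' Summits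
Literature HarnessLib`, 2026-09-04): N478 (the `T ∕ U` forms with the factor `2`), N484 `chebyshevC_sq_sub_S_sq`; `Literature.NumberTheory.LucasSequences.RecurrenceIdentities.V_two_mul`, `V_sq`
ARE the even-index integer identities (general `P, Q`) — cited, not restated; 0 hits for the 6 names below.

WHAT IS IN THE TREE.  N476, N478, N481, N483, N484; Literature `LucasSequences.RecurrenceIdentities` ((IV.2), (IV.6)).
THIS FILE (namespace `Summit.Ventures.HSemireg.Wedge.HankelOuter` continued; CHAINED on N484; 0 definitions):
* §1250 **`chebyshevC_two_mul_add_two`**, **`chebyshevC_two_mul_sub_two`**, **`chebyshevC_two_mul_add_one_sub_two`**, **`chebyshevC_two_mul_add_one_add_two`** (polynomial, all `k ∈ ℤ`, every ring);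
  `lucasV_one_two_mul_add_one_sub_two`, `lucasV_one_two_mul_add_one_add_two`.
CAVEATS.  `Q = 1` only on the integer side.  Nothing Ext-side.  New names only.
-/

open Module Polynomial
open scoped Matrix Polynomial

namespace Summit.Ventures.HSemireg.Wedge.HankelOuter

/-! ## §1250. Monic half-angle factorisations and `V_{2k+1} ∓ 2` -/

/-- **`C_{2k} + 2 = C_k²`** (all `k ∈ ℤ`, every commutative ring). [Ribenboim (IV.4); this file, §1250] -/
theorem chebyshevC_two_mul_add_two {R : Type*} [CommRing R] (k : ℤ) :
    Polynomial.Chebyshev.C R (2 * k) + 2 = Polynomial.Chebyshev.C R k ^ 2 := by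
  have h := Polynomial.Chebyshev.C_mul_C R k k
  rw [sub_self, Polynomial.Chebyshev.C_zero, show k + k = 2 * k by ring] at h
  linear_combination (-1 : R[X]) * h

/-- **`C_{2k} − 2 = (X² − 4) S_{k−1}²`** (all `k ∈ ℤ`, every commutative ring). [Ribenboim (IV.6); this file, §1250] -/
theorem chebyshevC_two_mul_sub_two {R : Type*} [CommRing R] (k : ℤ) :
    Polynomial.Chebyshev.C R (2 * k) - 2 = (Polynomial.X ^ 2 - 4) * Polynomial.Chebyshev.S R (k - 1) ^ 2 := by
  have h := chebyshevC_add_sub_C_sub (R := R) k k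
  rw [sub_self, Polynomial.Chebyshev.C_zero, show k + k = 2 * k by ring] at h
  linear_combination h

/-- **`C_{2k+1} − 2 = (X − 2)(S_k + S_{k−1})²`** (all `k ∈ ℤ`, every commutative ring). [Ribenboim Ch. 1 §IV; this file, §1250] -/
theorem chebyshevC_two_mul_add_one_sub_two {R : Type*} [CommRing R] (k : ℤ) :
    Polynomial.Chebyshev.C R (2 * k + 1) - 2 = (Polynomial.X - 2) * (Polynomial.Chebyshev.S R k + Polynomial.Chebyshev.S R (k - 1)) ^ 2 := by
  have h := chebyshevC_add_sub_C_sub (R := R) k (k + 1)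
  rw [show k + 1 + k = 2 * k + 1 by ring, add_sub_cancel_left, Polynomial.Chebyshev.C_one, add_sub_cancel_right] at h
  have hc := Polynomial.Chebyshev.S_sq_add_S_sq R (k - 1)
  rw [sub_add_cancel] at hc
  linear_combination h - (Polynomial.X - 2 : R[X]) * hc

/-- **`C_{2k+1} + 2 = (X + 2)(S_k − S_{k−1})²`** (all `k ∈ ℤ`, every commutative ring). [Ribenboim Ch. 1 §IV; this file, §1250] -/
theorem chebyshevC_two_mul_add_one_add_two {R : Type*} [CommRing R] (k : ℤ) :
    Polynomial.Chebyshev.C R (2 * k + 1) + 2 = (Polynomial.X + 2) * (Polynomial.Chebyshev.S R k - Polynomial.Chebyshev.S R (k - 1)) ^ 2 := by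
  have h := chebyshevC_add_sub_C_sub (R := R) k (k + 1)
  rw [show k + 1 + k = 2 * k + 1 by ring, add_sub_cancel_left, Polynomial.Chebyshev.C_one, add_sub_cancel_right] at h
  have hc := Polynomial.Chebyshev.S_sq_add_S_sq R (k - 1)
  rw [sub_add_cancel] at hc
  linear_combination h - (Polynomial.X + 2 : R[X]) * hc

/-- **`V_{2k+1} − 2 = (P − 2)(U_{k+1} + U_k)²`** for `U_0 = 0, U_1 = 1`, `V_0 = 2, V_1 = P`, `x_{j+2} = P x_{j+1} − x_j` over `ℤ` (even index: `Literature…RecurrenceIdentities.V_two_mul`, `V_sq`).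
[Ribenboim Ch. 1 §IV; this file, §1250] -/
theorem lucasV_one_two_mul_add_one_sub_two {P : ℤ} {U V : ℕ → ℤ} (hU0 : U 0 = 0) (hU1 : U 1 = 1) (hU : ∀ n, U (n + 2) = P * U (n + 1) - U n)
    (hV0 : V 0 = 2) (hV1 : V 1 = P) (hV : ∀ n, V (n + 2) = P * V (n + 1) - V n) (k : ℕ) : V (2 * k + 1) - 2 = (P - 2) * (U (k + 1) + U k) ^ 2 := by
  have h := congrArg (Polynomial.eval P) (chebyshevC_two_mul_add_one_sub_two (R := ℤ) (k : ℤ))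
  rw [eval_sub, eval_ofNat, eval_mul, eval_sub, eval_X, eval_ofNat, eval_pow, eval_add] at h
  rw [lucasV_one_eq_chebyshevC_eval hV0 hV1 hV (2 * k + 1), lucasU_one_eq_chebyshevS_eval hU0 hU1 hU (k + 1), lucasU_one_eq_chebyshevS_eval hU0 hU1 hU k,
    show (((k + 1 : ℕ) : ℤ) - 1 : ℤ) = (k : ℤ) by push_cast; ring, show (((2 * k + 1 : ℕ)) : ℤ) = 2 * (k : ℤ) + 1 by push_cast; ring]
  exact h

/-- **`V_{2k+1} + 2 = (P + 2)(U_{k+1} − U_k)²`.** [Ribenboim Ch. 1 §IV; this file, §1250] -/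
theorem lucasV_one_two_mul_add_one_add_two {P : ℤ} {U V : ℕ → ℤ} (hU0 : U 0 = 0) (hU1 : U 1 = 1) (hU : ∀ n, U (n + 2) = P * U (n + 1) - U n)
    (hV0 : V 0 = 2) (hV1 : V 1 = P) (hV : ∀ n, V (n + 2) = P * V (n + 1) - V n) (k : ℕ) : V (2 * k + 1) + 2 = (P + 2) * (U (k + 1) - U k) ^ 2 := by
  have h := congrArg (Polynomial.eval P) (chebyshevC_two_mul_add_one_add_two (R := ℤ) (k : ℤ))
  rw [eval_add, eval_ofNat, eval_mul, eval_add, eval_X, eval_ofNat, eval_pow, eval_sub] at h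
  rw [lucasV_one_eq_chebyshevC_eval hV0 hV1 hV (2 * k + 1), lucasU_one_eq_chebyshevS_eval hU0 hU1 hU (k + 1), lucasU_one_eq_chebyshevS_eval hU0 hU1 hU k,
    show (((k + 1 : ℕ) : ℤ) - 1 : ℤ) = (k : ℤ) by push_cast; ring, show (((2 * k + 1 : ℕ)) : ℤ) = 2 * (k : ℤ) + 1 by push_cast; ring]
  exact h

end Summit.Ventures.HSemireg.Wedge.HankelOuter
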